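import Summits.BirchSwinnertonDyer.BirchSwinnertonDyer.Theses.ClassRecordThree
import Summits.BirchSwinnertonDyer.BirchSwinnertonDyer.Theorems.ClassRecordThreeEulerHalvesAtThreeCoStepLDefs
import Summits.BirchSwinnertonDyer.BirchSwinnertonDyer.Theorems.ClassRecordThreeEulerHalvesAtThreeHybridInertSavingServable
import Literature.NumberTheory.EllipticCurves.ModularityVersionApProofs
import Literature.NumberTheory.EllipticCurves.TamagawaProofs
import Literature.NumberTheory.EllipticCurves.OggFormulaTameTypesTwoProofs
import Literature.NumberTheory.EllipticCurves.SzpiroLocalDataProofs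
import Literature.NumberTheory.DiophantineGeometry.ConductorRingOfIntegersProofs
import Literature.NumberTheory.DiophantineGeometry.ConductorTameProofs

/-!
# CartanServability — the residual population of `EulerHalvesAtThree` is always Cartan-servable (Lean, sorry-free)

Companion to `Cruxes/EulerHalvesAtThree/CartanServability.md` (v1.0 ad34bafc0440 … v1.3; this file = Lean v1.2), §5 (E3): the combinatorial
theorem behind **Corollary R**. `CartanServableAtThree` below is the VERBATIM copy of the definition in the
(unregistered) alternative line `Cruxes/EulerHalvesAtThree/Lines/cartan.lean` r2 (sha16 8bb7df8a0226b0b4, l.726–747).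

* `cartanServable_of_additiveCarrier` — modulo five LOCAL facts supplied as hypotheses (split ⇒ bad, `3 ∣ c_q` ⇒ bad,
  Fact T at `3`: `3 ∣ c₃` ⇒ split, `c_q = v_q(Δ)` for split `q` in the weak form `3 ∣ c_q ⇒ 3 ∣ v_q(Δ)`, finiteness of
  the bad primes), the Cartan-placement facts (tame additive `3`-carriers `q ≥ 5` have `v_q(N) = 2` — Fact N5; and
  **Lemma W** at `q = 2`: an additive `3`-carrier at `2` has `v₂(N) = 2`) and ONE additive `3`-carrier `q₀ ≠ 3`,
  the curve is `CartanServableAtThree` (frame recipe of the dossier's Table 2.1: rows 0 ∕ I.1⁻ ∕ I.2⁺).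
* `cartanServable_of_residualNormalFormAt` — the same with the additive carrier read off tam3-p1 g19's named residual
  predicate `Three.ResidualNormalFormAt` ((a) ∨ (b)); hence r2's `stub_coStepLResidualShapeOffCartanAtThree` has
  contradictory hypotheses and the Cartan line needs no IMC-grade input.
* `cartanServable_of_residualNormalFormAt_of_placement` (v1.1) — the five local facts DISCHARGED from the tree; only the two
  placement facts (N5) and Lemma W remain as hypotheses.
* `typeIVAtTwoTame` (v1.2) — **Lemma W PROVED** from the tree's Tate algorithm at `2` (types `IV`∕`IV*` have
  `ord₂ Δ_min = 4`∕`8`, Ogg's formula, `N = ∏ p^{f_p}`); `cartanServable_of_residualNormalFormAt_of_tame` — only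
  `Mult W 3`, (N5) and the residual predicate remain; `additiveThreeCarrierTame` — **(N5) PROVED** (Ogg–Saito `f = ε` off
  `2, 3`, the tree's `conductorExponent_eq_tameConductorExponent_holds`); `cartanServable_of_residualNormalFormAt_of_mult`
  — **only `Mult W 3` and the residual predicate remain: Cor R is unconditional in tree currency.**

Nothing here is registered or proposed; W-79 ∕ W-71 honoured. No summit statement is proved by this file.
-/

open scoped Classical NumberField

namespace Summit.BirchSwinnertonDyer.BirchSwinnertonDyer.Cruxes.EulerHalvesAtThree.CartanServability

open WeierstrassCurve IsDedekindDomain NumberField Field Literature.NumberTheory.EllipticCurves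
open Literature.NumberTheory.EllipticCurves.Rank1Residual

/-- VERBATIM copy of `Lines/cartan.lean` r2 `CartanServableAtThree` (l.726–747). -/
def CartanServableAtThree (W : WeierstrassCurve ℚ) [W.IsElliptic] [W.IsGloballyMinimal] : Prop :=
  ∃ C : Finset ℕ,
    (∀ q ∈ C, ∃ _ : Fact q.Prime, q ≠ 3 ∧ q ^ 2 ∣ W.conductorNorm ℤ ∧ ¬ q ^ 3 ∣ W.conductorNorm ℤ ∧
      3 ∣ (W.baseChange ℚ_[q]).localTamagawaNumber ℤ_[q]) ∧
    ((∃ q₁ : ℕ, ∀ (q : ℕ) [Fact q.Prime], q ∉ C → q ≠ q₁ →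
        ¬ 3 ∣ (W.baseChange ℚ_[q]).localTamagawaNumber ℤ_[q]) ∨
     ((∀ (q : ℕ) [Fact q.Prime], q ∉ C → 3 ∣ (W.baseChange ℚ_[q]).localTamagawaNumber ℤ_[q] →
          W.HasSplitMultiplicativeReductionAtPrime q) ∧
        ∃ S : Finset ℕ, (∀ ℓ ∈ S, ∃ _ : Fact ℓ.Prime, Mult W ℓ) ∧ Even S.card ∧ 3 ∈ S ∧
          (∀ (ℓ : ℕ) [Fact ℓ.Prime], ℓ ∉ S → W.HasSplitMultiplicativeReductionAtPrime ℓ →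
            ¬ 3 ∣ padicValInt ℓ W.minimalDiscriminantInt) ∧
          ((∃ (ℓ₁ : ℕ) (_ : Fact ℓ₁.Prime), Mult W ℓ₁ ∧ ¬ 3 ∣ padicValInt ℓ₁ W.minimalDiscriminantInt ∧
              (ℓ₁ ∈ S ∨ ∃ (t : ℕ) (_ : Fact t.Prime), Mult W t ∧ t ∉ S ∧ t ≠ ℓ₁)) ∨
            ∃ R ⊆ S, S.card = 2 * R.card ∧ ∀ q ∈ R, q ≠ 2 ∧ ¬ 3 ∣ q - 1)) ∨
     (∃ (q₁ : ℕ) (_ : Fact q₁.Prime), ¬ W.HasGoodReductionAtPrime q₁ ∧ q₁ ∉ C ∧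
        (∀ (q : ℕ) [Fact q.Prime], q ≠ q₁ → q ∉ C → 3 ∣ (W.baseChange ℚ_[q]).localTamagawaNumber ℤ_[q] →
          W.HasSplitMultiplicativeReductionAtPrime q) ∧
        ∃ S : Finset ℕ, (∀ ℓ ∈ S, ∃ _ : Fact ℓ.Prime, Mult W ℓ) ∧ Even S.card ∧ 3 ∈ S ∧ q₁ ∉ S ∧
          (∀ (ℓ : ℕ) [Fact ℓ.Prime], ℓ ∉ S → ℓ ≠ q₁ → W.HasSplitMultiplicativeReductionAtPrime ℓ →
            ¬ 3 ∣ padicValInt ℓ W.minimalDiscriminantInt)))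

/-- **Theorem (Corollary R, combinatorial core).** With `3` multiplicative, the local facts and the Cartan-placement
facts as hypotheses, ONE additive `3`-carrier `q₀ ≠ 3` makes the curve Cartan-servable. Proof = Table 2.1 of the dossier:
`C :=` all additive carriers (minus the exempt one in row I.1⁻), `S := {3} ∪` the split carriers `≠ 3` (minus the
exempt one in row I.2⁺), parity repaired by the (A1) exemption. -/
theorem cartanServable_of_additiveCarrier
    (W : WeierstrassCurve ℚ) [W.IsElliptic] [W.IsGloballyMinimal]
    (h3 : Mult W 3)
    (hmultbad : ∀ (ℓ : ℕ) [Fact ℓ.Prime], Mult W ℓ → ¬ W.HasGoodReductionAtPrime ℓ)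
    (hbad : ∀ (q : ℕ) [Fact q.Prime], 3 ∣ (W.baseChange ℚ_[q]).localTamagawaNumber ℤ_[q] →
      ¬ W.HasGoodReductionAtPrime q)
    (h3split : 3 ∣ (W.baseChange ℚ_[3]).localTamagawaNumber ℤ_[3] → W.HasSplitMultiplicativeReductionAtPrime 3)
    (hsplitc : ∀ (q : ℕ) [Fact q.Prime], W.HasSplitMultiplicativeReductionAtPrime q →
      3 ∣ (W.baseChange ℚ_[q]).localTamagawaNumber ℤ_[q] → 3 ∣ padicValInt q W.minimalDiscriminantInt)
    (htame : ∀ (q : ℕ) [Fact q.Prime], q ≠ 2 → q ≠ 3 → 3 ∣ (W.baseChange ℚ_[q]).localTamagawaNumber ℤ_[q] →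
      ¬ W.HasSplitMultiplicativeReductionAtPrime q → q ^ 2 ∣ W.conductorNorm ℤ ∧ ¬ q ^ 3 ∣ W.conductorNorm ℤ)
    (hW : 3 ∣ (W.baseChange ℚ_[2]).localTamagawaNumber ℤ_[2] → ¬ W.HasSplitMultiplicativeReductionAtPrime 2 →
      2 ^ 2 ∣ W.conductorNorm ℤ ∧ ¬ 2 ^ 3 ∣ W.conductorNorm ℤ)
    (hfin : ∃ P : Finset ℕ, ∀ (q : ℕ) [Fact q.Prime], ¬ W.HasGoodReductionAtPrime q → q ∈ P)
    (hA : ∃ (q₀ : ℕ) (_ : Fact q₀.Prime), q₀ ≠ 3 ∧ 3 ∣ (W.baseChange ℚ_[q₀]).localTamagawaNumber ℤ_[q₀] ∧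
      ¬ W.HasSplitMultiplicativeReductionAtPrime q₀) :
    CartanServableAtThree W := by
  classical
  have hsplit : ∀ (ℓ : ℕ) [Fact ℓ.Prime], W.HasSplitMultiplicativeReductionAtPrime ℓ → Mult W ℓ :=
    fun ℓ _ h => h.hasMultiplicativeReductionAtPrime
  obtain ⟨P, hP⟩ := hfin
  -- `A` = the Cartan places (additive `3`-carriers `≠ 3`), `B` = the split `3`-carriers `≠ 3`
  obtain ⟨A, hAm⟩ : ∃ A : Finset ℕ, ∀ q, q ∈ A ↔ q ∈ P ∧ ∃ _ : Fact q.Prime, q ≠ 3 ∧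
      3 ∣ (W.baseChange ℚ_[q]).localTamagawaNumber ℤ_[q] ∧ ¬ W.HasSplitMultiplicativeReductionAtPrime q :=
    ⟨P.filter (fun q => ∃ _ : Fact q.Prime, q ≠ 3 ∧
      3 ∣ (W.baseChange ℚ_[q]).localTamagawaNumber ℤ_[q] ∧ ¬ W.HasSplitMultiplicativeReductionAtPrime q),
      fun q => Finset.mem_filter⟩
  obtain ⟨B, hBm⟩ : ∃ B : Finset ℕ, ∀ q, q ∈ B ↔ q ∈ P ∧ ∃ _ : Fact q.Prime, q ≠ 3 ∧
      W.HasSplitMultiplicativeReductionAtPrime q ∧ 3 ∣ padicValInt q W.minimalDiscriminantInt :=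
    ⟨P.filter (fun q => ∃ _ : Fact q.Prime, q ≠ 3 ∧
      W.HasSplitMultiplicativeReductionAtPrime q ∧ 3 ∣ padicValInt q W.minimalDiscriminantInt),
      fun q => Finset.mem_filter⟩
  -- the (C) clause for every Cartan place
  have hAspec : ∀ q ∈ A, ∃ _ : Fact q.Prime, q ≠ 3 ∧ q ^ 2 ∣ W.conductorNorm ℤ ∧ ¬ q ^ 3 ∣ W.conductorNorm ℤ ∧
      3 ∣ (W.baseChange ℚ_[q]).localTamagawaNumber ℤ_[q] := by
    intro q hq
    obtain ⟨-, hF, hq3, hc, hns⟩ := (hAm q).mp hq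
    by_cases hq2 : q = 2
    · subst hq2
      exact ⟨hF, hq3, (hW hc hns).1, (hW hc hns).2, hc⟩
    · exact ⟨hF, hq3, (htame q hq2 hq3 hc hns).1, (htame q hq2 hq3 hc hns).2, hc⟩
  -- every additive carrier `≠ 3` is in `A`; every split carrier `≠ 3` is in `B`; `3 ∉ B`
  have hAin : ∀ (q : ℕ) [Fact q.Prime], q ≠ 3 → 3 ∣ (W.baseChange ℚ_[q]).localTamagawaNumber ℤ_[q] →
      ¬ W.HasSplitMultiplicativeReductionAtPrime q → q ∈ A :=
    fun q hF hq3 hc hns => (hAm q).mpr ⟨hP q (hbad q hc), hF, hq3, hc, hns⟩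
  have hBin : ∀ (ℓ : ℕ) [Fact ℓ.Prime], ℓ ≠ 3 → W.HasSplitMultiplicativeReductionAtPrime ℓ →
      3 ∣ padicValInt ℓ W.minimalDiscriminantInt → ℓ ∈ B :=
    fun ℓ hF hℓ3 hsp hv => (hBm ℓ).mpr ⟨hP ℓ (hmultbad ℓ (hsplit ℓ hsp)), hF, hℓ3, hsp, hv⟩
  have h3B : (3 : ℕ) ∉ B := fun h => by
    obtain ⟨-, -, h33, -, -⟩ := (hBm 3).mp h
    exact h33 rfl
  have hBmult : ∀ ℓ ∈ B, ∃ _ : Fact ℓ.Prime, Mult W ℓ := fun ℓ hℓ => by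
    obtain ⟨-, hF, -, hsp, -⟩ := (hBm ℓ).mp hℓ
    exact ⟨hF, hsplit ℓ hsp⟩
  -- an off-`A` `3`-carrier is `3` itself (then split, by Fact T) or split
  have hoffA : ∀ (q : ℕ) [Fact q.Prime], q ∉ A → 3 ∣ (W.baseChange ℚ_[q]).localTamagawaNumber ℤ_[q] →
      W.HasSplitMultiplicativeReductionAtPrime q := by
    intro q hF hqA hc
    by_contra hns
    by_cases hq3 : q = 3
    · subst hq3
      exact hns (h3split hc)
    · exact hqA (hAin q hq3 hc hns)
  obtain ⟨a, hFa, ha3, hca, hnsa⟩ := hA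
  have haA : a ∈ A := hAin a ha3 hca hnsa
  have haB : a ∉ B := fun h => by
    obtain ⟨-, _hF, -, hsp, -⟩ := (hBm a).mp h
    exact hnsa hsp
  rcases Nat.even_or_odd B.card with hBeven | hBodd
  · by_cases hB0 : B = ∅
    · -- Row 0: no split carrier `≠ 3`; frame (M) with `C := A`, the only possible off-`C` carrier being `3`
      refine ⟨A, hAspec, Or.inl ⟨3, ?_⟩⟩
      intro q hF hqA hq3 hc
      have hsp := hoffA q hqA hc
      have hqB : q ∈ B := hBin q hq3 hsp (hsplitc q hsp hc)
      rw [hB0] at hqB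
      exact Finset.notMem_empty q hqB
    · -- Row I.2⁺: `#B` even and nonempty; frame (A1) exempting one split carrier `b`, `C := A`, `S := {3} ∪ B ∖ {b}`
      obtain ⟨b, hb⟩ := Finset.nonempty_iff_ne_empty.mpr hB0
      obtain ⟨-, hFb, hb3, hspb, -⟩ := (hBm b).mp hb
      have hbA : b ∉ A := fun h => by
        obtain ⟨-, _hF, -, -, hns⟩ := (hAm b).mp h
        exact hns hspb
      refine ⟨A, hAspec, Or.inr (Or.inr ⟨b, hFb, hmultbad b (hsplit b hspb), hbA, ?_,
        insert 3 (B.erase b), ?_, ?_, Finset.mem_insert_self 3 _, ?_, ?_⟩)⟩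
      · intro q hF _ hqA hc
        exact hoffA q hqA hc
      · intro ℓ hℓ
        rcases Finset.mem_insert.mp hℓ with rfl | hℓ'
        · exact ⟨hF3, h3⟩
        · exact hBmult ℓ (Finset.mem_of_mem_erase hℓ')
      · have h3e : (3 : ℕ) ∉ B.erase b := fun h => h3B (Finset.mem_of_mem_erase h)
        rw [Finset.card_insert_of_notMem h3e, Finset.card_erase_of_mem hb,
          Nat.sub_add_cancel (Finset.card_pos.mpr ⟨b, hb⟩)]
        exact hBeven
      · intro h
        rcases Finset.mem_insert.mp h with h33 | hbe
        · exact hb3 h33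
        · exact Finset.notMem_erase b B hbe
      · intro ℓ hF hℓS hℓb hsp hv
        by_cases hℓ3 : ℓ = 3
        · subst hℓ3
          exact hℓS (Finset.mem_insert_self 3 _)
        · exact hℓS (Finset.mem_insert_of_mem (Finset.mem_erase.mpr ⟨hℓb, hBin ℓ hℓ3 hsp hv⟩))
  · -- Row I.1⁻: `#B` odd; frame (A1) exempting the additive carrier `a`, `C := A ∖ {a}`, `S := {3} ∪ B`
    refine ⟨A.erase a, fun q hq => hAspec q (Finset.mem_of_mem_erase hq),
      Or.inr (Or.inr ⟨a, hFa, hbad a hca, Finset.notMem_erase a A, ?_, insert 3 B, ?_, ?_,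
        Finset.mem_insert_self 3 _, ?_, ?_⟩)⟩
    · intro q hF hqa hqC hc
      by_contra hns
      by_cases hq3 : q = 3
      · subst hq3
        exact hns (h3split hc)
      · exact hqC (Finset.mem_erase.mpr ⟨hqa, hAin q hq3 hc hns⟩)
    · intro ℓ hℓ
      rcases Finset.mem_insert.mp hℓ with rfl | hℓ'
      · exact ⟨hF3, h3⟩
      · exact hBmult ℓ hℓ'
    · rw [Finset.card_insert_of_notMem h3B]
      exact hBodd.add_odd odd_one
    · intro h
      rcases Finset.mem_insert.mp h with h33 | haB'
      · exact ha3 h33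
      · exact haB haB'
    · intro ℓ hF hℓS _ hsp hv
      by_cases hℓ3 : ℓ = 3
      · subst hℓ3
        exact hℓS (Finset.mem_insert_self 3 _)
      · exact hℓS (Finset.mem_insert_of_mem (hBin ℓ hℓ3 hsp hv))
  where
  /-- the `Fact (Nat.Prime 3)` witness used for `3 ∈ S` -/
  hF3 : Fact (Nat.Prime 3) := ⟨Nat.prime_three⟩

/-- **Corollary R in r21∕r22 currency.** On tam3-p1 g19's residual population `Three.ResidualNormalFormAt` ((a) ∨ (b)),
with the same local ∕ placement facts as hypotheses, the curve is Cartan-servable: both disjuncts exhibit an additive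
`3`-carrier `≠ 3`. Hence `Lines/cartan.lean` r2's `stub_coStepLResidualShapeOffCartanAtThree`
(… → `ResidualNormalFormAt W` → `¬ CartanServableAtThree W` → CoStepL) has contradictory hypotheses. -/
theorem cartanServable_of_residualNormalFormAt
    (W : WeierstrassCurve ℚ) [W.IsElliptic] [W.IsGloballyMinimal]
    (h3 : Mult W 3)
    (hmultbad : ∀ (ℓ : ℕ) [Fact ℓ.Prime], Mult W ℓ → ¬ W.HasGoodReductionAtPrime ℓ)
    (hbad : ∀ (q : ℕ) [Fact q.Prime], 3 ∣ (W.baseChange ℚ_[q]).localTamagawaNumber ℤ_[q] →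
      ¬ W.HasGoodReductionAtPrime q)
    (h3split : 3 ∣ (W.baseChange ℚ_[3]).localTamagawaNumber ℤ_[3] → W.HasSplitMultiplicativeReductionAtPrime 3)
    (hsplitc : ∀ (q : ℕ) [Fact q.Prime], W.HasSplitMultiplicativeReductionAtPrime q →
      3 ∣ (W.baseChange ℚ_[q]).localTamagawaNumber ℤ_[q] → 3 ∣ padicValInt q W.minimalDiscriminantInt)
    (htame : ∀ (q : ℕ) [Fact q.Prime], q ≠ 2 → q ≠ 3 → 3 ∣ (W.baseChange ℚ_[q]).localTamagawaNumber ℤ_[q] →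
      ¬ W.HasSplitMultiplicativeReductionAtPrime q → q ^ 2 ∣ W.conductorNorm ℤ ∧ ¬ q ^ 3 ∣ W.conductorNorm ℤ)
    (hW : 3 ∣ (W.baseChange ℚ_[2]).localTamagawaNumber ℤ_[2] → ¬ W.HasSplitMultiplicativeReductionAtPrime 2 →
      2 ^ 2 ∣ W.conductorNorm ℤ ∧ ¬ 2 ^ 3 ∣ W.conductorNorm ℤ)
    (hfin : ∃ P : Finset ℕ, ∀ (q : ℕ) [Fact q.Prime], ¬ W.HasGoodReductionAtPrime q → q ∈ P)
    (hres : Summit.BirchSwinnertonDyer.Rank1Residual.X11b.Three.ResidualNormalFormAt W) :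
    CartanServableAtThree W := by
  refine cartanServable_of_additiveCarrier W h3 hmultbad hbad h3split hsplitc htame hW hfin ?_
  rcases hres with ⟨q₀, hF, hq3, hc, hns, -⟩ | ⟨q₁, hF, hq3, hc, hns, -⟩
  · exact ⟨q₀, hF, hq3, hc, hns⟩
  · exact ⟨q₁, hF, hq3, hc, hns⟩

/-- **Corollary R with the local facts DISCHARGED from the tree (v1.1).** Only the two Cartan-PLACEMENT facts remain as
hypotheses — (N5) `htame`: a tame additive `3`-carrier `q ≥ 5` has `v_q(N) = 2`, and **Lemma W** `hW`: an additive `3`-carrier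
at `2` has `v₂(N) = 2` — besides `Mult W 3` and the residual predicate. Discharged: Mult ⇒ bad
(`Rank1Residual.not_hasGoodReductionAtPrime_of_hasMultiplicativeReductionAtPrime`), `3 ∣ c_q` ⇒ bad
(`localTamagawaNumber_eq_one_of_hasGoodReduction_holds`), Fact T at `3` and `c = v(Δ)` for split carriers
(`Three.Koly.split_and_three_dvd_of_mult_of_three_dvd_localTamagawaNumber`), finiteness of the bad primes
(`dvd_conductorNorm_iff_not_hasGoodReductionAtPrime`, `conductorNorm_pos_holds`). -/
theorem cartanServable_of_residualNormalFormAt_of_placement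
    (W : WeierstrassCurve ℚ) [W.IsElliptic] [W.IsGloballyMinimal]
    (h3 : Mult W 3)
    (htame : ∀ (q : ℕ) [Fact q.Prime], q ≠ 2 → q ≠ 3 → 3 ∣ (W.baseChange ℚ_[q]).localTamagawaNumber ℤ_[q] →
      ¬ W.HasSplitMultiplicativeReductionAtPrime q → q ^ 2 ∣ W.conductorNorm ℤ ∧ ¬ q ^ 3 ∣ W.conductorNorm ℤ)
    (hW : 3 ∣ (W.baseChange ℚ_[2]).localTamagawaNumber ℤ_[2] → ¬ W.HasSplitMultiplicativeReductionAtPrime 2 →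
      2 ^ 2 ∣ W.conductorNorm ℤ ∧ ¬ 2 ^ 3 ∣ W.conductorNorm ℤ)
    (hres : Summit.BirchSwinnertonDyer.Rank1Residual.X11b.Three.ResidualNormalFormAt W) :
    CartanServableAtThree W := by
  refine cartanServable_of_residualNormalFormAt W h3 ?_ ?_ ?_ ?_ htame hW ?_ hres
  · intro ℓ _ hm
    exact not_hasGoodReductionAtPrime_of_hasMultiplicativeReductionAtPrime ℓ hm
  · intro q _ hc hg
    have hg' : ((W.baseChange ℚ_[q]).minimal ℤ_[q]).HasGoodReduction ℤ_[q] := hg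
    have h1 : (W.baseChange ℚ_[q]).localTamagawaNumber ℤ_[q] = 1 := by
      haveI := hg'
      exact WeierstrassCurve.localTamagawaNumber_eq_one_of_hasGoodReduction_holds ℤ_[q] (W.baseChange ℚ_[q])
    rw [h1] at hc
    exact absurd (Nat.le_of_dvd one_pos hc) (by norm_num)
  · intro hc
    exact (Summit.BirchSwinnertonDyer.Rank1Residual.X11b.Three.Koly.split_and_three_dvd_of_mult_of_three_dvd_localTamagawaNumber
      W 3 h3 hc).1
  · intro q _ hsp hc
    exact (Summit.BirchSwinnertonDyer.Rank1Residual.X11b.Three.Koly.split_and_three_dvd_of_mult_of_three_dvd_localTamagawaNumber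
      W q hsp.hasMultiplicativeReductionAtPrime hc).2
  · refine ⟨(W.conductorNorm ℤ).primeFactors, fun q _ hng => ?_⟩
    exact Nat.mem_primeFactors.mpr ⟨Fact.out, (W.dvd_conductorNorm_iff_not_hasGoodReductionAtPrime q).mpr hng,
      (WeierstrassCurve.conductorNorm_pos_holds W).ne'⟩

/-- **Lemma W (CartanServability.md §3), PROVED from the tree (v1.2): an additive `3`-carrier at `2` is TAME —
`3 ∣ c₂(E)` and `2` not split multiplicative force `v₂(N_E) = 2`.**  Tree road (all landed theorems, no named fact
left open): `3 ∣ c₂` ⇒ Kodaira type `IV` or `IV*` at the place `v₂` of `𝓞 ℚ`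
(`Three.split_or_typeIV_of_odd_prime_dvd_localTamagawaNumber`, the split alternative being excluded by hypothesis via
`hasSplitMultiplicativeReductionAtPrime_iff_hasSplitMultiplicativeReductionAt`); type `IV` (resp. `IV*`) at `2` has
`ord₂ Δ_min = 4` (resp. `8`) (`ordMinimalDiscriminant_eq_of_kodairaSymbolAt_IV_two` ∕ `_IVstar_two`, bsd.S15's
Tate-algorithm-at-`2` files); the tree DEFINES `f_v` by Ogg's formula `ord_v Δ_min + 1 − m_v`, so `f₂ = 2`; finally
`N_E = ∏ p ^ f_p` (`factorization_conductorNorm_primesEquiv_symm`, `conductorExponent_ringOfIntegers_eq`).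
On paper (§3 of the dossier) the same statement is local Galois theory (`E[3]^{I₂} ≅ Φ[3]`, Serre–Tate); here it is
Tate's algorithm.  So the r3 stub `stub_typeIVAtTwoTameAtThree` is not a stub at all: it is this theorem. -/
theorem typeIVAtTwoTame (W : WeierstrassCurve ℚ) [W.IsElliptic] [W.IsGloballyMinimal]
    (hc : 3 ∣ (W.baseChange ℚ_[2]).localTamagawaNumber ℤ_[2])
    (hns : ¬ W.HasSplitMultiplicativeReductionAtPrime 2) :
    2 ^ 2 ∣ W.conductorNorm ℤ ∧ ¬ 2 ^ 3 ∣ W.conductorNorm ℤ := by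
  classical
  set v : HeightOneSpectrum (𝓞 ℚ) := (Rat.HeightOneSpectrum.primesEquiv (R := 𝓞 ℚ)).symm ⟨2, Nat.prime_two⟩
    with hvdef
  have hpv : Rat.HeightOneSpectrum.primesEquiv v = ⟨2, Nat.prime_two⟩ := by
    rw [hvdef, Equiv.apply_symm_apply]
  have hv : (Rat.HeightOneSpectrum.primesEquiv v : ℕ) = 2 := by rw [hpv]
  have hv2 : (2 : 𝓞 ℚ) ∈ v.asIdeal := WeierstrassCurve.Rat.two_mem_primesEquiv_symm_two
  have h3' : 3 ∣ W.tamagawaNumberAt v := by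
    rw [tamagawaNumberAt_def, ← WeierstrassCurve.localTamagawaNumber_padic_eq_holds W v 2 hv]
    exact hc
  rcases Summit.BirchSwinnertonDyer.Rank1Residual.X11b.Three.split_or_typeIV_of_odd_prime_dvd_localTamagawaNumber
      W v Nat.prime_three (by decide) h3' with ⟨hs, -⟩ | ⟨-, hk, -⟩
  · exfalso
    have hs' := (W.hasSplitMultiplicativeReductionAtPrime_iff_hasSplitMultiplicativeReductionAt v).mpr hs
    have key : ∀ (r : ℕ) (hr : Fact r.Prime), (Rat.HeightOneSpectrum.primesEquiv v : ℕ) = r →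
        @WeierstrassCurve.HasSplitMultiplicativeReductionAtPrime W r hr := by
      rintro r hr rfl; exact hs'
    exact hns (key 2 inferInstance hv)
  · -- Kodaira `IV` ∕ `IV*` at `2`: `ord₂ Δ_min = 4` ∕ `8`, so Ogg's `f₂ = ord₂ Δ_min + 1 - m = 2`
    have hf : W.conductorExponent v = 2 := by
      rcases hk with hT | hT
      · have hord := (W.ordMinimalDiscriminant_eq_of_kodairaSymbolAt_IV_two hv2 hT).1
        unfold WeierstrassCurve.conductorExponent WeierstrassCurve.numComponentsAt
        rw [hord, hT]
        decide
      · have hord := (W.ordMinimalDiscriminant_eq_of_kodairaSymbolAt_IVstar_two hv2 hT).1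
        unfold WeierstrassCurve.conductorExponent WeierstrassCurve.numComponentsAt
        rw [hord, hT]
        decide
    -- `N_E = ∏ p ^ f_p`, read at the place of `ℤ` below `v`
    have h4 : (W.conductorNorm ℤ).factorization 2 = W.conductorExponent v := by
      rw [WeierstrassCurve.conductorExponent_ringOfIntegers_eq W v, hpv]
      exact WeierstrassCurve.factorization_conductorNorm_primesEquiv_symm W ⟨2, Nat.prime_two⟩
    have hfac : (W.conductorNorm ℤ).factorization 2 = 2 := by rw [h4, hf]
    have hN : W.conductorNorm ℤ ≠ 0 := (WeierstrassCurve.conductorNorm_pos_holds W).ne'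
    rw [Nat.prime_two.pow_dvd_iff_le_factorization hN, Nat.prime_two.pow_dvd_iff_le_factorization hN, hfac]
    omega

/-- **Corollary R with Lemma W discharged (v1.2).** The residual population of `EulerHalvesAtThree` is Cartan-servable
given only `Mult W 3` and the tame-placement fact (N5) for additive `3`-carriers `q ≥ 5` (in print: Ogg–Saito
`f_q = 2` for additive reduction in residue characteristic `≥ 5`, the tree's proved
`conductorExponent_eq_tameConductorExponent_holds`; left as the hypothesis `htame` here, in `AtPrime` currency). -/
theorem cartanServable_of_residualNormalFormAt_of_tame
    (W : WeierstrassCurve ℚ) [W.IsElliptic] [W.IsGloballyMinimal]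
    (h3 : Mult W 3)
    (htame : ∀ (q : ℕ) [Fact q.Prime], q ≠ 2 → q ≠ 3 → 3 ∣ (W.baseChange ℚ_[q]).localTamagawaNumber ℤ_[q] →
      ¬ W.HasSplitMultiplicativeReductionAtPrime q → q ^ 2 ∣ W.conductorNorm ℤ ∧ ¬ q ^ 3 ∣ W.conductorNorm ℤ)
    (hres : Summit.BirchSwinnertonDyer.Rank1Residual.X11b.Three.ResidualNormalFormAt W) :
    CartanServableAtThree W :=
  cartanServable_of_residualNormalFormAt_of_placement W h3 htame (typeIVAtTwoTame W) hres

/-- **(N5) PROVED from the tree (v1.2): an additive `3`-carrier `q ≠ 2, 3` is tame, `v_q(N_E) = 2`.**  Same road as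
`typeIVAtTwoTame`: `3 ∣ c_q` and `q` not split ⇒ Kodaira `IV`∕`IV*` at `v_q`; in residue characteristic `≠ 2, 3`
the tree's proved Ogg–Saito fact `conductorExponent_eq_tameConductorExponent_holds` (`f_v = ε_v`, Silverman *ATAEC*
IV.10.2(b), IV.10.4) gives `f_q = ε(IV) = ε(IV*) = 2`; then `N_E = ∏ p ^ f_p`. -/
theorem additiveThreeCarrierTame (W : WeierstrassCurve ℚ) [W.IsElliptic] [W.IsGloballyMinimal]
    (q : ℕ) [hq : Fact q.Prime] (hq2 : q ≠ 2) (hq3 : q ≠ 3)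
    (hc : 3 ∣ (W.baseChange ℚ_[q]).localTamagawaNumber ℤ_[q])
    (hns : ¬ W.HasSplitMultiplicativeReductionAtPrime q) :
    q ^ 2 ∣ W.conductorNorm ℤ ∧ ¬ q ^ 3 ∣ W.conductorNorm ℤ := by
  classical
  set v : HeightOneSpectrum (𝓞 ℚ) := (Rat.HeightOneSpectrum.primesEquiv (R := 𝓞 ℚ)).symm ⟨q, hq.out⟩
    with hvdef
  have hpv : Rat.HeightOneSpectrum.primesEquiv v = ⟨q, hq.out⟩ := by
    rw [hvdef, Equiv.apply_symm_apply]
  have hv : (Rat.HeightOneSpectrum.primesEquiv v : ℕ) = q := by rw [hpv]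
  have hvq : (q : 𝓞 ℚ) ∈ v.asIdeal :=
    (natCast_mem_asIdeal_iff_eq_primesEquiv_symm v hq.out).mpr hvdef
  have h3' : 3 ∣ W.tamagawaNumberAt v := by
    rw [tamagawaNumberAt_def, ← WeierstrassCurve.localTamagawaNumber_padic_eq_holds W v q hv]
    exact hc
  rcases Summit.BirchSwinnertonDyer.Rank1Residual.X11b.Three.split_or_typeIV_of_odd_prime_dvd_localTamagawaNumber
      W v Nat.prime_three (by decide) h3' with ⟨hs, -⟩ | ⟨-, hk, -⟩
  · exfalso
    have hs' := (W.hasSplitMultiplicativeReductionAtPrime_iff_hasSplitMultiplicativeReductionAt v).mpr hs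
    have key : ∀ (r : ℕ) (hr : Fact r.Prime), (Rat.HeightOneSpectrum.primesEquiv v : ℕ) = r →
        @WeierstrassCurve.HasSplitMultiplicativeReductionAtPrime W r hr := by
      rintro r hr rfl; exact hs'
    exact hns (key q hq hv)
  · -- residue characteristic `q ≠ 2, 3`: no wild conductor, `f_q = ε_q = 2` for `IV` ∕ `IV*`
    have hchar : ringChar ((𝓞 ℚ) ⧸ v.asIdeal) = q := by
      haveI : Nontrivial ((𝓞 ℚ) ⧸ v.asIdeal) := Ideal.Quotient.nontrivial_iff.2 v.isPrime.ne_top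
      have h0 : (q : (𝓞 ℚ) ⧸ v.asIdeal) = 0 := by
        rw [← map_natCast (Ideal.Quotient.mk v.asIdeal) q, Ideal.Quotient.eq_zero_iff_mem]
        exact hvq
      exact CharP.ringChar_of_prime_eq_zero hq.out h0
    have hf : W.conductorExponent v = 2 := by
      rw [WeierstrassCurve.conductorExponent_eq_tameConductorExponent_holds v W (by rw [hchar]; exact hq2)
        (by rw [hchar]; exact hq3)]
      rcases hk with hT | hT
      · rw [hT]; decide
      · rw [hT]; decide
    have h4 : (W.conductorNorm ℤ).factorization q = W.conductorExponent v := by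
      rw [WeierstrassCurve.conductorExponent_ringOfIntegers_eq W v, hpv]
      exact WeierstrassCurve.factorization_conductorNorm_primesEquiv_symm W ⟨q, hq.out⟩
    have hfac : (W.conductorNorm ℤ).factorization q = 2 := by rw [h4, hf]
    have hN : W.conductorNorm ℤ ≠ 0 := (WeierstrassCurve.conductorNorm_pos_holds W).ne'
    rw [hq.out.pow_dvd_iff_le_factorization hN, hq.out.pow_dvd_iff_le_factorization hN, hfac]
    omega

/-- **Corollary R, UNCONDITIONAL in tree currency (v1.2).** Every curve in the residual population of
`EulerHalvesAtThree` (`Three.ResidualNormalFormAt`, i.e. the population of `stub_coStepLResidualShapeAtThree` ∕ route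
item `EulerHalvesAtThreeCoStepLResidual`) with multiplicative reduction at `3` is Cartan-servable: all nine local inputs of
`cartanServable_of_additiveCarrier` are now theorems of the tree.  Hence on the Cartan road the "beyond-print residual" of
crux `19109` is EMPTY as a matter of Lean, not only of the dossier. -/
theorem cartanServable_of_residualNormalFormAt_of_mult
    (W : WeierstrassCurve ℚ) [W.IsElliptic] [W.IsGloballyMinimal]
    (h3 : Mult W 3)
    (hres : Summit.BirchSwinnertonDyer.Rank1Residual.X11b.Three.ResidualNormalFormAt W) :
    CartanServableAtThree W :=
  cartanServable_of_residualNormalFormAt_of_placement W h3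
    (fun q _ hq2 hq3 hc hns => additiveThreeCarrierTame W q hq2 hq3 hc hns) (typeIVAtTwoTame W) hres

end Summit.BirchSwinnertonDyer.BirchSwinnertonDyer.Cruxes.EulerHalvesAtThree.CartanServability
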